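import Literature.AnabelianGeometry.EtaleTheta.Discharge.Sec5Thm57CoherentFamilyOfRebase
import Literature.AnabelianGeometry.EtaleTheta.Discharge.Sec5Thm57KummerRigid
import Literature.AnabelianGeometry.EtaleTheta.Discharge.Sec5SeedsOfDivTransport

/-!
# [EtTh] §5, Theorem 5.7 at ALL levels for the genuine connected tower — the FINAL KNIT (pp. 329–331 / PDF pp. 103–105)

Mochizuki, *The étale theta function …*, Publ. RIMS **45** (2009) [cite: MochizukiEtTh2009, Thm 5.7 p.330 (PDF p.104); Rmk 4.3.2
p.318–319 (PDF pp.92–93); Prop 4.2 (iv) p.315 (PDF p.89); Lem 5.8 p.331 (PDF p.105); Thm 5.10 (i)(ii) p.333–334 (PDF pp.107–108)].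
Seat abc-iut-L2-d4 (gen 5; node `EtTh:Thm5.7`, row R219 «FINAL KNIT», FILE 3).  PROOF-ONLY (0 defs, no new named facts): the
COMPOSITION of FILE 1 `thetaRootPreservedAll_ofConnectedTemperoidYddFamily_ofAnchored_ofPulledConstants` (p442166: anchor at the first
root PRODUCED by abc-iut-w5-d245's p437125; `he`/`ef`/`θ₁`/`hstrv₁`/`hYdd₁` gone), FILE 2 `hfam_ofConnectedTemperoidFamily_of_rebase`
(abc-iut-w5-d245 p445776, over abc-iut-f-121's rebased Prop. 4.2 (iv) p443132/p438241), the seeds producer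
`exists_seeds_hdivcapcup_ofConnectedTemperoidData` (abc-iut-w5-d245 p445769) and this seat's Kummer-rigidity reduction (p445072).
RESULT `thetaRootPreservedAll_ofConnectedTemperoidYddFamily_final`: **Thm. 5.7 (root level, all identifications) at EVERY level of the
§5 tower over `B^temp(Π^tp_X)⁰` (`A_⊙^bs := Ÿ`, constants pulled back from `X₀`) for the self-equivalence of a Thm. 4.4 package `h44`**,
MODULO these NAMED inputs only: (A) `hnd`, `hN`, `hgc₁` (Lemma 5.8 at the first root), `hfac₁`, `hinj` [genuine instance]; (anchor)
`hΨFT` ("`Ψ` preserves Frobenius-trivial objects", [FrdI] Cor. 4.11 (ii)), `hbs` (`Ψ(A_1)^bs ≅ A_1^bs`, "characteristic", p.329), `hdivA`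
(Prop. 5.3 (vi) read at `A_1`), `hP24` (Prop. 2.4); (§4) the Thm. 4.4 data of `Ψ` (`h44`, `ψ`, `hpull`, `hii`, `h3`, `h4b`, `h8`, `h15a`,
`h15`, `hpull₂`), per level the Def. 4.1 (iv) datum `D N` of `α_{1,N}` with its pull-back law `hD N`, per anchor `hf` (Thm. 4.4 (ii) at
`A_1`), per anchor/level `hArises` (clause (e) pointwise) and `hebs` (base isomorphism of `Ψ` at `A_N` over `α_{1,N}`), per unit/level
`hroot` (`hroot₁N` + its `N`-th-power / saturation clauses — abc-iut-f-123 p442529, abc-iut-f-121 p443529/p438735 at the model), `hivP'`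
(Prop. 4.2 (iv) at the twisted level-1 pair); (C) `hc` — the level-1 discrepancy constant of every normalised transport is a `2l`-th
root of unity.  `…_final_of_kummerRigid`: the same with `hc`, `hgc₁` REPLACED by {`hK` (`⋂_N (K^×)^N = 1`), `hgc` (Lemma 5.8 at every
level), `hrigid` (Cor. 2.8 (i) ∘ Prop. 5.2 (iii) ∘ Thm. 5.6 in §5 currency: one `ζ ∈ μ_{2l}(K)` whose `N`-th roots shadow every level-`N`
transport discrepancy up to `Π_Y`-fixed units)} via `pow_two_l_eq_one_of_anchoredFamily_of_kummerRigid` (generic tower).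
HONEST FRAMING: kernel-checked implication for data so parametrised (the class `TemperedFrobenioid T₀ (ConnectedPart (BTemp X.Pi)) VD`
is not shown inhabited here); nothing asserts any result of [EtTh] unconditionally; typed ≠ discharged — PROVED modulo the displayed
binders; no side taken on anything downstream ([IUTchIII] Cor. 3.12 in particular). -/

noncomputable section

namespace Literature.AnabelianGeometry.EtaleTheta

open CategoryTheory Opposite Literature.AlgebraicGeometry.Frobenioids Literature.AnabelianGeometry.SemiGraphs
  Literature.AnabelianGeometry.SemiGraphs.GaloisObjects

universe u₀ v₀ w v v' u u'

namespace ThetaFrobenioidTower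

section Generic

variable {C : Type u} [Category.{v} C] {D : Type u'} [Category.{v'} D] (𝔗 : ThetaFrobenioidTower.{w} C D)
  (Ψ : C ≌ C)

/-- **The anchored family's level-1 constant is a `2l`-th root of unity, from Kummer rigidity** — the inner step of
`thetaRootPreservedAll_of_anchoredFamily_of_kummerRigid` (p445072) ISOLATED: for a normalised anchor `(α₁, β₁, u₁)` and a family
`(a_N, b_N, w_N)_N` coherent with it, the discrepancies descend (`w_N ≫ β_{1,N} = β_{1,N} ≫ u₁`, `discrepancy_comp_beta_of_transports`),
so `w_N` is an `N`-th root of the constant `c := u₁` (`hconst`); then `pow_two_l_eq_one_of_kummerRigid`.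
[cite: MochizukiEtTh2009, Thm 5.7 p.330 (PDF p.104); Rmk 4.3.2 p.319 (PDF p.93); Lem 5.8 p.331 (PDF p.105)] -/
theorem pow_two_l_eq_one_of_anchoredFamily_of_kummerRigid (hepi : ∀ ⦃X Y : C⦄ (f : X ⟶ Y), Epi f)
    (hconst : ∀ (N : ℕ+) (u : Aut (𝔗.BN N)) (hu : u ∈ (𝔗.atLevel N).units (𝔗.BN N)) (u₁ : Aut (𝔗.BN 1))
      (hu₁ : u₁ ∈ (𝔗.atLevel 1).units (𝔗.BN 1)) (c : 𝔗.Kˣ),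
      u.hom ≫ 𝔗.β (one_dvd_level N) = 𝔗.β (one_dvd_level N) ≫ u₁.hom →
      (𝔗.atLevel 1).unitsToBirat (𝔗.BN 1) ⟨u₁, hu₁⟩ = 𝔗.constEmb 1 c →
        (𝔗.atLevel N).unitsToBirat (𝔗.BN N) ⟨u, hu⟩ ^ (N : ℕ) = 𝔗.constEmb N c)
    (hK : ∀ x : 𝔗.Kˣ, (∀ N : ℕ+, ∃ d : 𝔗.Kˣ, d ^ (N : ℕ) = x) → x = 1)
    (hgc : ∀ (N : ℕ+) (u : (𝔗.atLevel N).units (𝔗.BN N)),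
      (∀ y ∈ (𝔗.atLevel N).imPiY, 𝔗.sgpCap N y * (u : Aut (𝔗.BN N)) * (𝔗.sgpCap N y)⁻¹ = u) →
        (𝔗.atLevel N).unitsToBirat (𝔗.BN N) u ∈ (𝔗.constEmb N).range)
    {α₁ : Ψ.functor.obj (𝔗.AN 1) ≅ 𝔗.AN 1} {β₁ : Ψ.functor.obj (𝔗.BN 1) ≅ 𝔗.BN 1} {u₁ : Aut (𝔗.BN 1)}
    (hT₁ : α₁.inv ≫ Ψ.functor.map (𝔗.sCap 1) ≫ β₁.hom = 𝔗.sCap 1)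
    (hT₁' : α₁.inv ≫ Ψ.functor.map (𝔗.sCup 1) ≫ β₁.hom = 𝔗.sCup 1 ≫ u₁.hom)
    (hu₁ : u₁ ∈ (𝔗.atLevel 1).units (𝔗.BN 1))
    (a : ∀ N : ℕ+, Ψ.functor.obj (𝔗.AN N) ≅ 𝔗.AN N) (b : ∀ N : ℕ+, Ψ.functor.obj (𝔗.BN N) ≅ 𝔗.BN N)
    (w : ∀ N : ℕ+, Aut (𝔗.BN N))
    (hw : ∀ N : ℕ+, w N ∈ (𝔗.atLevel N).units (𝔗.BN N))
    (hT : ∀ N : ℕ+, (a N).inv ≫ Ψ.functor.map (𝔗.sCap N) ≫ (b N).hom = 𝔗.sCap N)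
    (hT' : ∀ N : ℕ+, (a N).inv ≫ Ψ.functor.map (𝔗.sCup N) ≫ (b N).hom = 𝔗.sCup N ≫ (w N).hom)
    (hΨα : ∀ N : ℕ+,
      (a N).inv ≫ Ψ.functor.map (𝔗.α (one_dvd_level N)) ≫ α₁.hom = 𝔗.α (one_dvd_level N))
    (hΨβ : ∀ N : ℕ+,
      (b N).inv ≫ Ψ.functor.map (𝔗.β (one_dvd_level N)) ≫ β₁.hom = 𝔗.β (one_dvd_level N))
    (hrigid : ∃ ζ : 𝔗.Kˣ, ζ ^ (2 * 𝔗.l) = 1 ∧ ∀ N : ℕ+, ∃ ξ : (𝔗.atLevel N).units (𝔗.BN N),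
      (𝔗.atLevel N).unitsToBirat (𝔗.BN N) ξ ^ (N : ℕ) = 𝔗.constEmb N ζ ∧
      ∀ y ∈ (𝔗.atLevel N).imPiY,
        𝔗.sgpCap N y * (w N * (ξ : Aut (𝔗.BN N))⁻¹) * (𝔗.sgpCap N y)⁻¹ = w N * (ξ : Aut (𝔗.BN N))⁻¹)
    {c : 𝔗.Kˣ} (hc₁ : (𝔗.atLevel 1).unitsToBirat (𝔗.BN 1) ⟨u₁, hu₁⟩ = 𝔗.constEmb 1 c) :
    c ^ (2 * 𝔗.l) = 1 := by
  refine 𝔗.pow_two_l_eq_one_of_kummerRigid hK hgc w hw (fun N => ?_) hrigid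
  have hT₁r : α₁.inv ≫ Ψ.functor.map (𝔗.sCap 1) ≫ β₁.hom =
      (Iso.refl (𝔗.AN 1)).hom ≫ 𝔗.sCap 1 ≫ (1 : Aut (𝔗.BN 1)).hom := by
    rw [hT₁, Iso.refl_hom, Category.id_comp]
    show 𝔗.sCap 1 = 𝔗.sCap 1 ≫ (Iso.refl (𝔗.BN 1)).hom
    rw [Iso.refl_hom, Category.comp_id]
  have hT₁r' : α₁.inv ≫ Ψ.functor.map (𝔗.sCup 1) ≫ β₁.hom = (Iso.refl (𝔗.AN 1)).hom ≫ 𝔗.sCup 1 ≫ u₁.hom := by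
    rw [hT₁', Iso.refl_hom, Category.id_comp]
  have hTr : (a N).inv ≫ Ψ.functor.map (𝔗.sCap N) ≫ (b N).hom =
      (Iso.refl (𝔗.AN N)).hom ≫ 𝔗.sCap N ≫ (1 : Aut (𝔗.BN N)).hom := by
    rw [hT N, Iso.refl_hom, Category.id_comp]
    show 𝔗.sCap N = 𝔗.sCap N ≫ (Iso.refl (𝔗.BN N)).hom
    rw [Iso.refl_hom, Category.comp_id]
  have hTr' : (a N).inv ≫ Ψ.functor.map (𝔗.sCup N) ≫ (b N).hom = (Iso.refl (𝔗.AN N)).hom ≫ 𝔗.sCup N ≫ (w N).hom := by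
    rw [hT' N, Iso.refl_hom, Category.id_comp]
  have hcomm := (𝔗.discrepancy_comp_beta_of_transports Ψ hepi (one_dvd_level N) α₁ (a N) β₁ (b N) (hΨα N) (hΨβ N)
    (by rw [Iso.refl_hom, Iso.refl_hom, Category.id_comp, Category.comp_id]) hT₁r hT₁r' hTr hTr').2.2
  rw [inv_one, one_mul, inv_one, one_mul] at hcomm
  exact hconst N (w N) (hw N) u₁ hu₁ c hcomm hc₁

end Generic

section Genuine


variable {K : Type u₀} [Field K] {X : SemiGraphs.TemperedArithmeticGroup.{u₀} K} {D₀ : Type u₀} [Category.{v₀} D₀]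
  {V : FrdIMonoidStub.{w}} {T₀ : RealifiedDivisorMonoids (D₀ := D₀) V}
  {VD : FrdICatStub.{u₀ + 1, u₀, w} (ConnectedPart (BTemp X.Pi))}
  {tf : TemperedFrobenioid T₀ (ConnectedPart (BTemp X.Pi)) VD} {hZ : tf.monoidType = MonoidType.Z}
  {hP : ∀ A : (ConnectedPart (BTemp X.Pi))ᵒᵖ, IsPerfect (tf.Φ.carrier A)}
  {NH : Subgroup (Field.absoluteGaloisGroup K) → tf.category → ℕ+ → Prop}
  {E : Set ℕ+} (𝒯 : ThetaEnvTower.{max u₀ w} E) (ιX : 𝒯.PiX ≃ₜ* X.Pi)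
  {pullFrac : ∀ {A A' : (BiKummerSetting.mkOfConnectedTemperoidYddTower X tf hZ hP NH 𝒯 ιX).C} (_ : A' ⟶ A),
    (BiKummerSetting.mkOfConnectedTemperoidYddTower X tf hZ hP NH 𝒯 ιX).biratUnits A →
      (BiKummerSetting.mkOfConnectedTemperoidYddTower X tf hZ hP NH 𝒯 ιX).biratUnits A'}
  {lv : ℕ+}
  {θ : (BiKummerSetting.mkOfConnectedTemperoidYddTower X tf hZ hP NH 𝒯 ιX).biratUnits
    (BiKummerSetting.mkOfConnectedTemperoidYddTower X tf hZ hP NH 𝒯 ιX).Aodot}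
  {Bl : (BiKummerSetting.mkOfConnectedTemperoidYddTower X tf hZ hP NH 𝒯 ιX).C}
  {Pl : (BiKummerSetting.mkOfConnectedTemperoidYddTower X tf hZ hP NH 𝒯 ιX).FractionPair θ Bl}
  {Rl : (BiKummerSetting.mkOfConnectedTemperoidYddTower X tf hZ hP NH 𝒯 ιX).NthRoot θ Pl lv pullFrac}
  (h : ModelFrobenioid.Hypotheses tf.divisorMonoid tf.ratFnFunctor)
  (Q : FrobenioidTheta.ThetaSubquotientStub.{w} (ConnectedPart (BTemp X.Pi))) (odd_l : Odd (lv : ℕ))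
  (R : ∀ N : ℕ+, (BiKummerSetting.mkOfConnectedTemperoidYddTower X tf hZ hP NH 𝒯 ιX).NthRoot Rl.root Rl.pair N pullFrac)
  (K' : Type w) [Field K'] {X₀ : ConnectedPart (BTemp X.Pi)}
  (hX₀ : ∀ Y : ConnectedPart (BTemp X.Pi), Subsingleton (Y ⟶ X₀)) (t : ∀ N : ℕ+, (R N).BN.base ⟶ X₀)
  (c₀ : K'ˣ →* (tf.ratFnFunctor.obj (op X₀))ˣ)
  (hinj : ∀ N : ℕ+, Function.Injective ((Units.map (tf.ratFnFunctor.map (t N).op).hom).comp c₀))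
  (hinvc : ∀ (N : ℕ+) (g : Aut (R N).AN.base),
    pull tf.divisorMonoid g.hom (ModelFrobenioid.div (R N).pair.num) = ModelFrobenioid.div (R N).pair.num)
  (hinvp : ∀ (N : ℕ+) (y : 𝒯.PiX), y ∈ 𝒯.PiYdd →
    pull tf.divisorMonoid ((BiKummerSetting.mkOfConnectedTemperoidYddTower X tf hZ hP NH 𝒯 ιX).galoisSurj (R N).AN.base
      (R N).αData.isGalois (ιX y)).hom (ModelFrobenioid.div (R N).pair.den) = ModelFrobenioid.div (R N).pair.den)
  (α : ∀ {N N' : ℕ+}, (N : ℕ) ∣ N' → ((R N').AN ⟶ (R N).AN))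
  (β : ∀ {N N' : ℕ+}, (N : ℕ) ∣ N' → ((R N').BN ⟶ (R N).BN))
  (comm_sCap : ∀ {N N' : ℕ+} (hd : (N : ℕ) ∣ N'), (R N').pair.num ≫ β hd = α hd ≫ (R N).pair.num)
  (comm_sCup : ∀ {N N' : ℕ+} (hd : (N : ℕ) ∣ N'), (R N').pair.den ≫ β hd = α hd ≫ (R N).pair.den)
  (isIsometry_α : ∀ {N N' : ℕ+} (hd : (N : ℕ) ∣ N'),
    ((BiKummerSetting.mkOfConnectedTemperoidYddTower X tf hZ hP NH 𝒯 ιX).sec5Stub h).pre.IsIsometry (α hd))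
  (degFr_α : ∀ {N N' : ℕ+} (hd : (N : ℕ) ∣ N'),
    (((BiKummerSetting.mkOfConnectedTemperoidYddTower X tf hZ hP NH 𝒯 ιX).sec5Stub h).pre.degFr (α hd) : ℕ) * N = N')
  (isIsometry_β : ∀ {N N' : ℕ+} (hd : (N : ℕ) ∣ N'),
    ((BiKummerSetting.mkOfConnectedTemperoidYddTower X tf hZ hP NH 𝒯 ιX).sec5Stub h).pre.IsIsometry (β hd))
  (degFr_β : ∀ {N N' : ℕ+} (hd : (N : ℕ) ∣ N'),
    (((BiKummerSetting.mkOfConnectedTemperoidYddTower X tf hZ hP NH 𝒯 ιX).sec5Stub h).pre.degFr (β hd) : ℕ) * N = N')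
  (baseFrob_α : ∀ {N N' : ℕ+} (hd : (N : ℕ) ∣ N'),
    (BiKummerSetting.mkOfConnectedTemperoidYddTower X tf hZ hP NH 𝒯 ιX).IsOfBaseFrobeniusType (α hd))

  (h44 : BiKummerSetting.Thm44Hyp (BiKummerSetting.mkOfConnectedTemperoidYddTower X tf hZ hP NH 𝒯 ιX)
    (BiKummerSetting.mkOfConnectedTemperoidYddTower X tf hZ hP NH 𝒯 ιX))
  (ψ : ∀ A : (BiKummerSetting.mkOfConnectedTemperoidYddTower X tf hZ hP NH 𝒯 ιX).C,
    (BiKummerSetting.mkOfConnectedTemperoidYddTower X tf hZ hP NH 𝒯 ιX).biratUnits A ≃*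
      (BiKummerSetting.mkOfConnectedTemperoidYddTower X tf hZ hP NH 𝒯 ιX).biratUnits (h44.Ψ.functor.obj A))
  (hpull : ∀ {A A' : (BiKummerSetting.mkOfConnectedTemperoidYddTower X tf hZ hP NH 𝒯 ιX).C} (φ : A' ⟶ A)
    (f : (BiKummerSetting.mkOfConnectedTemperoidYddTower X tf hZ hP NH 𝒯 ιX).biratUnits A),
      ψ A' (pullFrac φ f) = pullFrac (h44.Ψ.functor.map φ) (ψ A f))
  (hii : BiKummerSetting.Thm44_ii h44 ψ) (h3 : h44.PreservesFrobeniusStructure) (h4b : h44.PreservesBaseFrobeniusTypeData)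
  (h8 : h44.PreservesAmple) (h15a : h44.PreservesFixedByHA ψ) (h15 : h44.PreservesSaturated ψ)
  (hpull₂ : ∀ {X' Y Z : (BiKummerSetting.mkOfConnectedTemperoidYddTower X tf hZ hP NH 𝒯 ιX).C} (φ : X' ⟶ Y) (χ : Y ⟶ Z)
    (g : (BiKummerSetting.mkOfConnectedTemperoidYddTower X tf hZ hP NH 𝒯 ιX).biratUnits Z),
      pullFrac (φ ≫ χ) g = pullFrac φ (pullFrac χ g))
  -- (B1)/(B1′): the Def. 4.1 (iv) datum of each transition `α_{1,N}` and its pull-back compatibility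
  (D : ∀ N : ℕ+, (BiKummerSetting.mkOfConnectedTemperoidYddTower X tf hZ hP NH 𝒯 ιX).BaseFrobeniusTypeData (α (one_dvd_level N)))
  (hD : ∀ N : ℕ+, pullFrac (D N).α₁ (R 1).root = pullFrac (R N).αData.α₁ Rl.root)

include hX₀ h comm_sCap comm_sCup isIsometry_α degFr_α isIsometry_β degFr_β hpull hii h3 h4b h8 h15a h15 hpull₂ hD in
/-- **[EtTh] Theorem 5.7 (root level) at ALL levels for the genuine connected tower with pulled-back constants — FINAL KNIT.**
`ThetaRootPreservedAll h44.Ψ` for the §5 tower `T = ofConnectedTemperoidFamily …` over `B^temp(Π^tp_X)⁰` (`A_⊙^bs := Ÿ`, constants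
`B(t_N)^× ∘ c₀` pulled back from `X₀`): FILE 1 (anchored capstone, p442166) ∘ abc-iut-w5-d245's seeds (p445769) ∘ FILE 2 (coherent family
from abc-iut-f-121's rebased Prop. 4.2 (iv), p445776/p443132).  Every remaining binder is a NAMED print input — see the module docstring
for the list and its locators; the tower is bound by `hT` (instantiate with `rfl`).
[cite: MochizukiEtTh2009, Thm 5.7 p.329–330 (PDF pp.103–104); Thm 5.10 (ii) p.334 (PDF p.108); Rmk 4.3.2 p.318–319 (PDF pp.92–93); Prop 4.2 (iv) p.315 (PDF p.89); Lem 5.8 p.331 (PDF p.105)] -/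
theorem thetaRootPreservedAll_ofConnectedTemperoidYddFamily_final
    (T : ThetaFrobenioidTower.{w} (BiKummerSetting.mkOfConnectedTemperoidYddTower X tf hZ hP NH 𝒯 ιX).C
      (ConnectedPart (BTemp X.Pi)))
    (hT : T = ofConnectedTemperoidFamily h Q odd_l R ιX K' (fun N => (Units.map (tf.ratFnFunctor.map (t N).op).hom).comp c₀)
      hinj hinvc hinvp α β comm_sCap comm_sCup isIsometry_α degFr_α isIsometry_β degFr_β baseFrob_α)
    (hnd : IsNonDilatingOn tf.divisorMonoid)
    (hN : ∃ A : (BiKummerSetting.mkOfConnectedTemperoidYddTower X tf hZ hP NH 𝒯 ιX).C,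
      ¬ (PreFrobenioidData.ofModel tf.divisorMonoid tf.ratFnFunctor tf.divBNatTrans).IsGroupLikeObj A)
    (hgc₁ : ∀ u : (T.atLevel 1).units (T.BN 1),
      (∀ y ∈ (T.atLevel 1).imPiY, T.sgpCap 1 y * (u : Aut (T.BN 1)) * (T.sgpCap 1 y)⁻¹ = u) →
        (T.atLevel 1).unitsToBirat (T.BN 1) u ∈ (T.constEmb 1).range)
    (hfac₁ : ∀ y ∈ (T.atLevel 1).imPiY, ∃ x ∈ (T.atLevel 1).HB, ∀ u ∈ (T.atLevel 1).units (T.BN 1),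
      T.sgpCap 1 y * u * (T.sgpCap 1 y)⁻¹ = T.sgpCap 1 x * u * (T.sgpCap 1 x)⁻¹)
    -- the seeds of the anchor, PRODUCED (abc-iut-w5-d245 p445769) from:
    (hΨFT : PreFrobenioidData.PreservesObj h44.Ψ.functor T.pre.IsFrobeniusTrivial T.pre.IsFrobeniusTrivial)
    (hbs : T.pre.BaseIsomorphic (h44.Ψ.functor.obj (T.AN 1)) (T.AN 1))
    (hdivA : ∀ αA : h44.Ψ.functor.obj (T.AN 1) ≅ T.AN 1, ∃ ε : Aut (T.AN 1),
      T.pre.div (αA.inv ≫ h44.Ψ.functor.map (T.sCap 1)) = T.pre.div (ε.hom ≫ T.sCap 1) ∧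
      T.pre.div (αA.inv ≫ h44.Ψ.functor.map (T.sCup 1)) = T.pre.div (ε.hom ≫ T.sCup 1))
    (hP24 : ∀ γ : 𝒯.PiX ≃ₜ* 𝒯.PiX, 𝒯.PiYdd.map γ.toMulEquiv.toMonoidHom = 𝒯.PiYdd)
    -- per anchor: Thm. 4.4 (ii) birational compatibility of the anchor at `A_1` with the twisted fraction
    (hf : ∀ (α₁ : h44.Ψ.functor.obj (R 1).AN ≅ (R 1).AN) (β₁ : h44.Ψ.functor.obj (R 1).BN ≅ (R 1).BN) (u₁ : Aut (R 1).BN)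
      (hu₁ : u₁ ∈ (BiKummerSetting.mkOfConnectedTemperoidYddTower X tf hZ hP NH 𝒯 ιX).units (R 1).BN),
      α₁.inv ≫ h44.Ψ.functor.map (R 1).pair.num ≫ β₁.hom = (R 1).pair.num →
      α₁.inv ≫ h44.Ψ.functor.map (R 1).pair.den ≫ β₁.hom = (R 1).pair.den ≫ u₁.hom →
        pullFrac α₁.hom
          ((BiKummerSetting.mkOfConnectedTemperoidYddTower X tf hZ hP NH 𝒯 ιX).fracOf (R 1).pair.num ((R 1).pair.den ≫ u₁.hom)
            (R 1).pair.isPreStep_num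
            ((BiKummerSetting.mkOfConnectedTemperoidYddTower X tf hZ hP NH 𝒯 ιX).isPreStep_comp_aut (R 1).pair.isPreStep_den u₁)
            ((BiKummerSetting.mkOfConnectedTemperoidYddTower X tf hZ hP NH 𝒯 ιX).baseEquivalent_comp_unit (R 1).pair.base_eq hu₁)) =
          ψ (R 1).AN (R 1).root)
    -- per anchor and level: clause (e) pointwise at the anchor, and the base isomorphism of `Ψ` at `A_N` over `α_{1,N}`
    (hArises : ∀ (α₁ : h44.Ψ.functor.obj (R 1).AN ≅ (R 1).AN) (N : ℕ+),
      (BiKummerSetting.mkOfConnectedTemperoidYddTower X tf hZ hP NH 𝒯 ιX).ArisesFromBaseFrobeniusPair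
        ((D N).G.map (h44.Ψ.functor.mapAut (R N).AN)) (h44.Ψ.functor.map (D N).α₂) (h44.Ψ.functor.map (D N).α₁ ≫ α₁.hom))
    (hebs : ∀ (α₁ : h44.Ψ.functor.obj (R 1).AN ≅ (R 1).AN) (N : ℕ+),
      ∃ ebs : (BiKummerSetting.mkOfConnectedTemperoidYddTower X tf hZ hP NH 𝒯 ιX).base.obj (R N).AN ≅
          (BiKummerSetting.mkOfConnectedTemperoidYddTower X tf hZ hP NH 𝒯 ιX).base.obj (h44.Ψ.functor.obj (R N).AN),
        (BiKummerSetting.mkOfConnectedTemperoidYddTower X tf hZ hP NH 𝒯 ιX).base.map (α (one_dvd_level N)) =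
          ebs.hom ≫ (BiKummerSetting.mkOfConnectedTemperoidYddTower X tf hZ hP NH 𝒯 ιX).base.map
            (h44.Ψ.functor.map (α (one_dvd_level N)) ≫ α₁.hom))
    -- per unit `u₁` and level: abc-iut-L2-d4's `hroot₁N` with its birational clauses (Lem. 5.8 / Def. 4.1 (iii))
    (hroot : ∀ (u₁ : Aut (R 1).BN) (hu₁ : u₁ ∈ (BiKummerSetting.mkOfConnectedTemperoidYddTower X tf hZ hP NH 𝒯 ιX).units (R 1).BN)
      (N : ℕ+), ∃ (ut : Aut (R N).BN) (hut : ut ∈ (BiKummerSetting.mkOfConnectedTemperoidYddTower X tf hZ hP NH 𝒯 ιX).units (R N).BN),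
        ut.hom ≫ β (one_dvd_level N) = β (one_dvd_level N) ≫ u₁.hom ∧
        (BiKummerSetting.mkOfConnectedTemperoidYddTower X tf hZ hP NH 𝒯 ιX).fracOf (R N).pair.num ((R N).pair.den ≫ ut.hom)
            (R N).pair.isPreStep_num
            ((BiKummerSetting.mkOfConnectedTemperoidYddTower X tf hZ hP NH 𝒯 ιX).isPreStep_comp_aut (R N).pair.isPreStep_den ut)
            ((BiKummerSetting.mkOfConnectedTemperoidYddTower X tf hZ hP NH 𝒯 ιX).baseEquivalent_comp_unit (R N).pair.base_eq hut) ^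
            (N : ℕ) =
          pullFrac (D N).α₁
            ((BiKummerSetting.mkOfConnectedTemperoidYddTower X tf hZ hP NH 𝒯 ιX).fracOf (R 1).pair.num ((R 1).pair.den ≫ u₁.hom)
              (R 1).pair.isPreStep_num
              ((BiKummerSetting.mkOfConnectedTemperoidYddTower X tf hZ hP NH 𝒯 ιX).isPreStep_comp_aut (R 1).pair.isPreStep_den u₁)
              ((BiKummerSetting.mkOfConnectedTemperoidYddTower X tf hZ hP NH 𝒯 ιX).baseEquivalent_comp_unit (R 1).pair.base_eq
                hu₁)) ∧
        (BiKummerSetting.mkOfConnectedTemperoidYddTower X tf hZ hP NH 𝒯 ιX).IsSaturated (R N).AN N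
          (pullFrac (D N).α₁
            ((BiKummerSetting.mkOfConnectedTemperoidYddTower X tf hZ hP NH 𝒯 ιX).fracOf (R 1).pair.num ((R 1).pair.den ≫ u₁.hom)
              (R 1).pair.isPreStep_num
              ((BiKummerSetting.mkOfConnectedTemperoidYddTower X tf hZ hP NH 𝒯 ιX).isPreStep_comp_aut (R 1).pair.isPreStep_den u₁)
              ((BiKummerSetting.mkOfConnectedTemperoidYddTower X tf hZ hP NH 𝒯 ιX).baseEquivalent_comp_unit (R 1).pair.base_eq
                hu₁))))
    -- Prop. 4.2 (iv) at the `u₁`-twisted level-1 pair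
    (hivP' : ∀ (u₁ : Aut (R 1).BN) (hu₁ : u₁ ∈ (BiKummerSetting.mkOfConnectedTemperoidYddTower X tf hZ hP NH 𝒯 ιX).units (R 1).BN)
      (N : ℕ+)
      (R' R'' : (BiKummerSetting.mkOfConnectedTemperoidYddTower X tf hZ hP NH 𝒯 ιX).NthRoot
        ((BiKummerSetting.mkOfConnectedTemperoidYddTower X tf hZ hP NH 𝒯 ιX).fracOf (R 1).pair.num ((R 1).pair.den ≫ u₁.hom)
          (R 1).pair.isPreStep_num
          ((BiKummerSetting.mkOfConnectedTemperoidYddTower X tf hZ hP NH 𝒯 ιX).isPreStep_comp_aut (R 1).pair.isPreStep_den u₁)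
          ((BiKummerSetting.mkOfConnectedTemperoidYddTower X tf hZ hP NH 𝒯 ιX).baseEquivalent_comp_unit (R 1).pair.base_eq hu₁))
        ((R 1).pair.twistUnit u₁ hu₁ rfl
          (BiKummerSetting.disjointSupports_twistUnit h.isDivisorial (R 1).pair u₁)) N pullFrac)
      (ebs : (BiKummerSetting.mkOfConnectedTemperoidYddTower X tf hZ hP NH 𝒯 ιX).base.obj R'.AN ≅
        (BiKummerSetting.mkOfConnectedTemperoidYddTower X tf hZ hP NH 𝒯 ιX).base.obj R''.AN),
      (BiKummerSetting.mkOfConnectedTemperoidYddTower X tf hZ hP NH 𝒯 ιX).base.map R'.α =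
        ebs.hom ≫ (BiKummerSetting.mkOfConnectedTemperoidYddTower X tf hZ hP NH 𝒯 ιX).base.map R''.α →
        ∃ (v : (BiKummerSetting.mkOfConnectedTemperoidYddTower X tf hZ hP NH 𝒯 ιX).mu R'.BN N) (ζA : R'.AN ≅ R''.AN)
          (ζB : R'.BN ≅ R''.BN),
          ζA.hom ≫ R''.pair.num = R'.pair.num ≫ ζB.hom ∧
          ζA.hom ≫ R''.pair.den = (R'.pair.den ≫ (v : Aut R'.BN).hom) ≫ ζB.hom ∧
          ζA.hom ≫ R''.α = R'.α ∧ ζB.hom ≫ R''.β = R'.β ∧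
          (BiKummerSetting.mkOfConnectedTemperoidYddTower X tf hZ hP NH 𝒯 ιX).base.mapIso ζA = ebs)
    -- (C): the level-1 discrepancy constant of every normalised transport is a `2l`-th root of unity
    (hc : ∀ (α₁ : h44.Ψ.functor.obj (T.AN 1) ≅ T.AN 1) (β₁ : h44.Ψ.functor.obj (T.BN 1) ≅ T.BN 1) (u₁ : Aut (T.BN 1))
      (hu₁ : u₁ ∈ (T.atLevel 1).units (T.BN 1)),
      α₁.inv ≫ h44.Ψ.functor.map (T.sCap 1) ≫ β₁.hom = T.sCap 1 →
      α₁.inv ≫ h44.Ψ.functor.map (T.sCup 1) ≫ β₁.hom = T.sCup 1 ≫ u₁.hom →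
        ∀ c : T.Kˣ, (T.atLevel 1).unitsToBirat (T.BN 1) ⟨u₁, hu₁⟩ = T.constEmb 1 c → c ^ (2 * T.l) = 1) :
    T.ThetaRootPreservedAll h44.Ψ := by
  have hfam := hfam_ofConnectedTemperoidFamily_of_rebase 𝒯 ιX h Q odd_l R K' t c₀ hinj hinvc hinvp α β comm_sCap comm_sCup
    isIsometry_α degFr_α isIsometry_β degFr_β baseFrob_α h44 ψ hpull hii h3 h4b h8 h15a h15 hpull₂ D hD T hT hf hArises hebs hroot hivP'
  subst hT
  obtain ⟨αs, βs, -, hdivcap₁, hdivcup₁⟩ :=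
    ThetaFrobenioid.exists_seeds_hdivcapcup_ofConnectedTemperoidData (T := 𝒯.level ⟨1, 𝒯.one_mem⟩) h Q odd_l (R 1) ιX K'
      ((Units.map (tf.ratFnFunctor.map (t 1).op).hom).comp c₀) (hinj 1) (hinvc 1) (hinvp 1) h44.Ψ hΨFT hbs hdivA
  exact thetaRootPreservedAll_ofConnectedTemperoidYddFamily_ofAnchored_ofPulledConstants 𝒯 ιX h Q odd_l R K' hX₀ t c₀ hinj hinvc
    hinvp α β comm_sCap comm_sCup isIsometry_α degFr_α isIsometry_β degFr_β baseFrob_α _ rfl hnd hN hgc₁ h44.Ψ hfac₁ αs βs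
    hdivcap₁ hdivcup₁ hP24 hfam hc


include hX₀ h comm_sCap comm_sCup isIsometry_α degFr_α isIsometry_β degFr_β hpull hii h3 h4b h8 h15a h15 hpull₂ hD in
/-- **[EtTh] Theorem 5.7 at the genuine connected tower — FINAL KNIT, KUMMER-RIGIDITY FORM**: as `…_final`, with `hc` and `hgc₁`
REPLACED by {`hK` (`⋂_N (K^×)^N = 1`), `hgc` (Lemma 5.8 at every level), `hrigid` (one `ζ ∈ μ_{2l}(K)` whose `N`-th roots in `O^×(B_N)` shadow
every level-`N` transport discrepancy up to a `Π_Y`-fixed unit — print's «rigidity of the étale theta function [Cor. 2.8 (i)] applied to the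
Kummer classes of Prop. 5.2 (iii) … Thm. 5.6»)}; `hc` is DERIVED per anchor from FILE 2's family (`pow_two_l_eq_one_of_anchoredFamily_of_kummerRigid`).
[cite: MochizukiEtTh2009, Thm 5.7 p.329–330 (PDF pp.103–104); Rmk 5.7.1 p.330 (PDF p.104); Lem 5.8 p.331 (PDF p.105); Prop 3.2 (iii) p.296 (PDF p.70)] -/
theorem thetaRootPreservedAll_ofConnectedTemperoidYddFamily_final_of_kummerRigid
    (T : ThetaFrobenioidTower.{w} (BiKummerSetting.mkOfConnectedTemperoidYddTower X tf hZ hP NH 𝒯 ιX).C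
      (ConnectedPart (BTemp X.Pi)))
    (hT : T = ofConnectedTemperoidFamily h Q odd_l R ιX K' (fun N => (Units.map (tf.ratFnFunctor.map (t N).op).hom).comp c₀)
      hinj hinvc hinvp α β comm_sCap comm_sCup isIsometry_α degFr_α isIsometry_β degFr_β baseFrob_α)
    (hnd : IsNonDilatingOn tf.divisorMonoid)
    (hN : ∃ A : (BiKummerSetting.mkOfConnectedTemperoidYddTower X tf hZ hP NH 𝒯 ιX).C,
      ¬ (PreFrobenioidData.ofModel tf.divisorMonoid tf.ratFnFunctor tf.divBNatTrans).IsGroupLikeObj A)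
    (hfac₁ : ∀ y ∈ (T.atLevel 1).imPiY, ∃ x ∈ (T.atLevel 1).HB, ∀ u ∈ (T.atLevel 1).units (T.BN 1),
      T.sgpCap 1 y * u * (T.sgpCap 1 y)⁻¹ = T.sgpCap 1 x * u * (T.sgpCap 1 x)⁻¹)
    (hΨFT : PreFrobenioidData.PreservesObj h44.Ψ.functor T.pre.IsFrobeniusTrivial T.pre.IsFrobeniusTrivial)
    (hbs : T.pre.BaseIsomorphic (h44.Ψ.functor.obj (T.AN 1)) (T.AN 1))
    (hdivA : ∀ αA : h44.Ψ.functor.obj (T.AN 1) ≅ T.AN 1, ∃ ε : Aut (T.AN 1),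
      T.pre.div (αA.inv ≫ h44.Ψ.functor.map (T.sCap 1)) = T.pre.div (ε.hom ≫ T.sCap 1) ∧
      T.pre.div (αA.inv ≫ h44.Ψ.functor.map (T.sCup 1)) = T.pre.div (ε.hom ≫ T.sCup 1))
    (hP24 : ∀ γ : 𝒯.PiX ≃ₜ* 𝒯.PiX, 𝒯.PiYdd.map γ.toMulEquiv.toMonoidHom = 𝒯.PiYdd)
    (hf : ∀ (α₁ : h44.Ψ.functor.obj (R 1).AN ≅ (R 1).AN) (β₁ : h44.Ψ.functor.obj (R 1).BN ≅ (R 1).BN) (u₁ : Aut (R 1).BN)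
      (hu₁ : u₁ ∈ (BiKummerSetting.mkOfConnectedTemperoidYddTower X tf hZ hP NH 𝒯 ιX).units (R 1).BN),
      α₁.inv ≫ h44.Ψ.functor.map (R 1).pair.num ≫ β₁.hom = (R 1).pair.num →
      α₁.inv ≫ h44.Ψ.functor.map (R 1).pair.den ≫ β₁.hom = (R 1).pair.den ≫ u₁.hom →
        pullFrac α₁.hom
          ((BiKummerSetting.mkOfConnectedTemperoidYddTower X tf hZ hP NH 𝒯 ιX).fracOf (R 1).pair.num ((R 1).pair.den ≫ u₁.hom)
            (R 1).pair.isPreStep_num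
            ((BiKummerSetting.mkOfConnectedTemperoidYddTower X tf hZ hP NH 𝒯 ιX).isPreStep_comp_aut (R 1).pair.isPreStep_den u₁)
            ((BiKummerSetting.mkOfConnectedTemperoidYddTower X tf hZ hP NH 𝒯 ιX).baseEquivalent_comp_unit (R 1).pair.base_eq hu₁)) =
          ψ (R 1).AN (R 1).root)
    (hArises : ∀ (α₁ : h44.Ψ.functor.obj (R 1).AN ≅ (R 1).AN) (N : ℕ+),
      (BiKummerSetting.mkOfConnectedTemperoidYddTower X tf hZ hP NH 𝒯 ιX).ArisesFromBaseFrobeniusPair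
        ((D N).G.map (h44.Ψ.functor.mapAut (R N).AN)) (h44.Ψ.functor.map (D N).α₂) (h44.Ψ.functor.map (D N).α₁ ≫ α₁.hom))
    (hebs : ∀ (α₁ : h44.Ψ.functor.obj (R 1).AN ≅ (R 1).AN) (N : ℕ+),
      ∃ ebs : (BiKummerSetting.mkOfConnectedTemperoidYddTower X tf hZ hP NH 𝒯 ιX).base.obj (R N).AN ≅
          (BiKummerSetting.mkOfConnectedTemperoidYddTower X tf hZ hP NH 𝒯 ιX).base.obj (h44.Ψ.functor.obj (R N).AN),
        (BiKummerSetting.mkOfConnectedTemperoidYddTower X tf hZ hP NH 𝒯 ιX).base.map (α (one_dvd_level N)) =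
          ebs.hom ≫ (BiKummerSetting.mkOfConnectedTemperoidYddTower X tf hZ hP NH 𝒯 ιX).base.map
            (h44.Ψ.functor.map (α (one_dvd_level N)) ≫ α₁.hom))
    (hroot : ∀ (u₁ : Aut (R 1).BN) (hu₁ : u₁ ∈ (BiKummerSetting.mkOfConnectedTemperoidYddTower X tf hZ hP NH 𝒯 ιX).units (R 1).BN)
      (N : ℕ+), ∃ (ut : Aut (R N).BN) (hut : ut ∈ (BiKummerSetting.mkOfConnectedTemperoidYddTower X tf hZ hP NH 𝒯 ιX).units (R N).BN),
        ut.hom ≫ β (one_dvd_level N) = β (one_dvd_level N) ≫ u₁.hom ∧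
        (BiKummerSetting.mkOfConnectedTemperoidYddTower X tf hZ hP NH 𝒯 ιX).fracOf (R N).pair.num ((R N).pair.den ≫ ut.hom)
            (R N).pair.isPreStep_num
            ((BiKummerSetting.mkOfConnectedTemperoidYddTower X tf hZ hP NH 𝒯 ιX).isPreStep_comp_aut (R N).pair.isPreStep_den ut)
            ((BiKummerSetting.mkOfConnectedTemperoidYddTower X tf hZ hP NH 𝒯 ιX).baseEquivalent_comp_unit (R N).pair.base_eq hut) ^
            (N : ℕ) =
          pullFrac (D N).α₁
            ((BiKummerSetting.mkOfConnectedTemperoidYddTower X tf hZ hP NH 𝒯 ιX).fracOf (R 1).pair.num ((R 1).pair.den ≫ u₁.hom)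
              (R 1).pair.isPreStep_num
              ((BiKummerSetting.mkOfConnectedTemperoidYddTower X tf hZ hP NH 𝒯 ιX).isPreStep_comp_aut (R 1).pair.isPreStep_den u₁)
              ((BiKummerSetting.mkOfConnectedTemperoidYddTower X tf hZ hP NH 𝒯 ιX).baseEquivalent_comp_unit (R 1).pair.base_eq
                hu₁)) ∧
        (BiKummerSetting.mkOfConnectedTemperoidYddTower X tf hZ hP NH 𝒯 ιX).IsSaturated (R N).AN N
          (pullFrac (D N).α₁
            ((BiKummerSetting.mkOfConnectedTemperoidYddTower X tf hZ hP NH 𝒯 ιX).fracOf (R 1).pair.num ((R 1).pair.den ≫ u₁.hom)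
              (R 1).pair.isPreStep_num
              ((BiKummerSetting.mkOfConnectedTemperoidYddTower X tf hZ hP NH 𝒯 ιX).isPreStep_comp_aut (R 1).pair.isPreStep_den u₁)
              ((BiKummerSetting.mkOfConnectedTemperoidYddTower X tf hZ hP NH 𝒯 ιX).baseEquivalent_comp_unit (R 1).pair.base_eq
                hu₁))))
    (hivP' : ∀ (u₁ : Aut (R 1).BN) (hu₁ : u₁ ∈ (BiKummerSetting.mkOfConnectedTemperoidYddTower X tf hZ hP NH 𝒯 ιX).units (R 1).BN)
      (N : ℕ+)
      (R' R'' : (BiKummerSetting.mkOfConnectedTemperoidYddTower X tf hZ hP NH 𝒯 ιX).NthRoot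
        ((BiKummerSetting.mkOfConnectedTemperoidYddTower X tf hZ hP NH 𝒯 ιX).fracOf (R 1).pair.num ((R 1).pair.den ≫ u₁.hom)
          (R 1).pair.isPreStep_num
          ((BiKummerSetting.mkOfConnectedTemperoidYddTower X tf hZ hP NH 𝒯 ιX).isPreStep_comp_aut (R 1).pair.isPreStep_den u₁)
          ((BiKummerSetting.mkOfConnectedTemperoidYddTower X tf hZ hP NH 𝒯 ιX).baseEquivalent_comp_unit (R 1).pair.base_eq hu₁))
        ((R 1).pair.twistUnit u₁ hu₁ rfl
          (BiKummerSetting.disjointSupports_twistUnit h.isDivisorial (R 1).pair u₁)) N pullFrac)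
      (ebs : (BiKummerSetting.mkOfConnectedTemperoidYddTower X tf hZ hP NH 𝒯 ιX).base.obj R'.AN ≅
        (BiKummerSetting.mkOfConnectedTemperoidYddTower X tf hZ hP NH 𝒯 ιX).base.obj R''.AN),
      (BiKummerSetting.mkOfConnectedTemperoidYddTower X tf hZ hP NH 𝒯 ιX).base.map R'.α =
        ebs.hom ≫ (BiKummerSetting.mkOfConnectedTemperoidYddTower X tf hZ hP NH 𝒯 ιX).base.map R''.α →
        ∃ (v : (BiKummerSetting.mkOfConnectedTemperoidYddTower X tf hZ hP NH 𝒯 ιX).mu R'.BN N) (ζA : R'.AN ≅ R''.AN)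
          (ζB : R'.BN ≅ R''.BN),
          ζA.hom ≫ R''.pair.num = R'.pair.num ≫ ζB.hom ∧
          ζA.hom ≫ R''.pair.den = (R'.pair.den ≫ (v : Aut R'.BN).hom) ≫ ζB.hom ∧
          ζA.hom ≫ R''.α = R'.α ∧ ζB.hom ≫ R''.β = R'.β ∧
          (BiKummerSetting.mkOfConnectedTemperoidYddTower X tf hZ hP NH 𝒯 ιX).base.mapIso ζA = ebs)
    -- (C) in Kummer-rigidity form (`Sec5Thm57KummerRigid.lean`): no divisible constants, Lemma 5.8 at EVERY level, and the
    -- Π_Y-Kummer character of every level-`N` transport discrepancy is that of ONE `ζ ∈ μ_{2l}(K)` (Cor. 2.8 (i) ∘ Prop. 5.2 (iii) ∘ Thm. 5.6)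
    (hK : ∀ x : T.Kˣ, (∀ N : ℕ+, ∃ d : T.Kˣ, d ^ (N : ℕ) = x) → x = 1)
    (hgc : ∀ (N : ℕ+) (u : (T.atLevel N).units (T.BN N)),
      (∀ y ∈ (T.atLevel N).imPiY, T.sgpCap N y * (u : Aut (T.BN N)) * (T.sgpCap N y)⁻¹ = u) →
        (T.atLevel N).unitsToBirat (T.BN N) u ∈ (T.constEmb N).range)
    (hrigid : ∃ ζ : T.Kˣ, ζ ^ (2 * T.l) = 1 ∧ ∀ (N : ℕ+) (a : h44.Ψ.functor.obj (T.AN N) ≅ T.AN N)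
      (b : h44.Ψ.functor.obj (T.BN N) ≅ T.BN N) (w : Aut (T.BN N)), w ∈ (T.atLevel N).units (T.BN N) →
      a.inv ≫ h44.Ψ.functor.map (T.sCap N) ≫ b.hom = T.sCap N →
      a.inv ≫ h44.Ψ.functor.map (T.sCup N) ≫ b.hom = T.sCup N ≫ w.hom →
        ∃ ξ : (T.atLevel N).units (T.BN N), (T.atLevel N).unitsToBirat (T.BN N) ξ ^ (N : ℕ) = T.constEmb N ζ ∧
          ∀ y ∈ (T.atLevel N).imPiY, T.sgpCap N y * (w * (ξ : Aut (T.BN N))⁻¹) * (T.sgpCap N y)⁻¹ = w * (ξ : Aut (T.BN N))⁻¹) :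
    T.ThetaRootPreservedAll h44.Ψ := by
  have hfam := hfam_ofConnectedTemperoidFamily_of_rebase 𝒯 ιX h Q odd_l R K' t c₀ hinj hinvc hinvp α β comm_sCap comm_sCup
    isIsometry_α degFr_α isIsometry_β degFr_β baseFrob_α h44 ψ hpull hii h3 h4b h8 h15a h15 hpull₂ D hD T hT hf hArises hebs hroot hivP'
  refine thetaRootPreservedAll_ofConnectedTemperoidYddFamily_final 𝒯 ιX h Q odd_l R K' hX₀ t c₀ hinj hinvc hinvp α β comm_sCap
    comm_sCup isIsometry_α degFr_α isIsometry_β degFr_β baseFrob_α h44 ψ hpull hii h3 h4b h8 h15a h15 hpull₂ D hD T hT hnd hN (hgc 1)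
    hfac₁ hΨFT hbs hdivA hP24 hf hArises hebs hroot hivP' ?_
  -- (C) for every normalised anchor, from the coherent family and Kummer rigidity
  intro α₁ β₁ u₁ hu₁ hnum hden c hc₁
  choose a b w hw hTf hTf' hΨα hΨβ using hfam α₁ β₁ u₁ hu₁ hnum hden
  obtain ⟨ζ, hζ, hR⟩ := hrigid
  subst hT
  refine pow_two_l_eq_one_of_anchoredFamily_of_kummerRigid _ h44.Ψ ?_ ?_ hK hgc hnum hden hu₁ a b w hw hTf hTf' hΨα hΨβ
    ⟨ζ, hζ, fun N => hR N (a N) (b N) (w N) (hw N) (hTf N) (hTf' N)⟩ hc₁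
  · exact ThetaFrobenioid.epi_of_model (DivB := tf.divBNatTrans) h
  · delta ofConnectedTemperoidFamily
    exact hconst_ofBiKummerFamily' h _ Q odd_l R ιX
      (fun N => BiKummerSetting.mkOfConnectedTemperoid_isOpen_ker_galoisSurj X tf hZ hP NH _ _ _ (R N).AN.base
        (R N).αData.isGalois)
      _ K' (fun N => (Units.map (tf.ratFnFunctor.map (t N).op).hom).comp c₀) hinj
      (fun N => ThetaFrobenioid.hdivc_of_pull_invariant h.isDivisorial (R N) (ThetaFrobenioid.strvOfBiKummerData h (R N))
        (ThetaFrobenioid.baseMap_strvOfBiKummerData h (R N)) (hinvc N))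
      (div_strv_comp_den_connFamily h R ιX hinvp)
      α β comm_sCap comm_sCup isIsometry_α degFr_α isIsometry_β degFr_β baseFrob_α
      (fun hd => rho_comm_β_of_natural R ιX
        (BiKummerSetting.mkOfConnectedTemperoid_galoisSurj_natural X tf hZ hP NH _ _ _) α β comm_sCap hd)
      (fun N c => tf.ratFnFunctor_map_unitsMap_comp_of_subsingleton (t 1) (t N) (β (one_dvd_level N)) c₀ c)

end Genuine

end ThetaFrobenioidTower

end Literature.AnabelianGeometry.EtaleTheta

end
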